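import Mathlib
import Literature.Analysis.Complex.BoundedPowerSums
import HarnessLib

/-!
# Exponential polynomials dominate every quadratic bound on long intervals

Helper file for line `cofinite-weil-index-staircase` of the crux
`RuelleBand.CofiniteCriticalLine` (item stmt-RiemannHypothesis-2064): the registered stub
`stub_expPolyDominates` (stub C2 of the lead's skeleton), a statement of pure
finite-dimensional analysis with no zeta input.

**Statement.** Let `s` be a finite index set, `λᵢ` (`i ∈ s`) DISTINCT complex exponents off
the imaginary axis (`Re λᵢ ≠ 0`) and `cᵢ ≠ 0` complex weights. For every real `K` there is a
length `L ≥ 0` such that the only coefficient vectors `w` with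
`‖∑_{i ∈ s} cᵢ wᵢ e^{λᵢ x}‖² ≤ K · ∑_{i ∈ s} ‖wᵢ‖²` for all `|x| ≤ L` vanish on `s`.

**Proof.**
* (a) *Pointwise unboundedness* (`stub_expPolyDominates_unbounded`). For a fixed coefficient
  vector `v ≠ 0` on `↥s` the exponential polynomial `x ↦ ∑ⱼ cⱼ vⱼ e^{λⱼ x}` is unbounded on
  `ℝ`: a bounded one has vanishing coefficient sum on every fibre `{j | λⱼ = μ}` with `Re μ ≠ 0`
  (`Literature.Analysis.Complex.BoundedPowerSum.sum_fiber_eq_zero_of_exp_real`, applied on the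
  finite index type `↥s`, where every family is summable and locally finite and the `tsum` is a
  finite sum), and by injectivity the fibres are singletons, so `cⱼ vⱼ = 0` for all `j`.
* (b) *Uniformity* (`stub_expPolyDominates_finite_abscissae`). The unit sphere
  `{v | ∑ⱼ ‖vⱼ‖² = 1}` of the coefficient space `↥s → ℂ` is compact (closed and bounded in a
  proper space); the open sets `{v | K < ‖∑ⱼ cⱼ vⱼ e^{λⱼ x}‖²}`, `x ∈ ℝ`, cover it by (a), and
  a finite subcover yields finitely many abscissae `t ⊆ ℝ`.
* (c) *Homogeneity* (`stub_expPolyDominates`). Put `L = ∑_{x ∈ t} |x|`. For `w ≠ 0` on `s`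
  normalise `v = w / r`, `r² = ∑_{i ∈ s} ‖wᵢ‖²`; both sides of the hypothesis scale by `r²`, so
  the hypothesis at the abscissa supplied by (b) is violated.

All three statements are standard (`[folklore]`); we know no canonical printed source.
-/

-- the summit-side namespace `Summit.RiemannHypothesis.RiemannHypothesis.…` (summit = problem) repeats
-- a component by design (single-problem summit, CONVENTIONS §1), so the linter must be off here.
set_option linter.dupNamespace false

noncomputable section

open Complex Filter Set
open scoped BigOperators Topology

namespace Summit.RiemannHypothesis.RiemannHypothesis.Theorems.RuelleBandCofiniteCriticalLine

/-- **(a) Pointwise unboundedness.** For exponents `λ` injective on the finite set `s` with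
`Re λᵢ ≠ 0`, non-zero weights `cᵢ` (`i ∈ s`) and a coefficient vector `v ≠ 0` on `↥s`, the
exponential polynomial `x ↦ ∑ⱼ cⱼ vⱼ e^{λⱼ x}` exceeds every real bound `M` somewhere on `ℝ`
(a bounded exponential polynomial with exponents off the imaginary axis has zero coefficient on
each singleton fibre, `BoundedPowerSum.sum_fiber_eq_zero_of_exp_real`). [folklore] -/
theorem stub_expPolyDominates_unbounded {ι : Type} {s : Finset ι} {lam c : ι → ℂ}
    (hinj : Set.InjOn lam ↑s) (hre : ∀ i ∈ s, (lam i).re ≠ 0) (hc : ∀ i ∈ s, c i ≠ 0)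
    {v : ↥s → ℂ} (hv : v ≠ 0) (M : ℝ) :
    ∃ x : ℝ, M < ‖∑ j : ↥s, c j * v j * cexp (lam j * x)‖ := by
  by_contra! hM
  obtain ⟨j₀, hj₀⟩ : ∃ j, v j ≠ 0 := by
    by_contra! h
    exact hv (funext h)
  have key := Literature.Analysis.Complex.BoundedPowerSum.sum_fiber_eq_zero_of_exp_real
    (ι := ↥s) (lam := fun j => lam j) (c := fun j => c j * v j)
    (R := ∑ j : ↥s, |(lam j).re|) (M := M) Summable.of_finite
    (fun j => Finset.single_le_sum (f := fun k : ↥s => |(lam k).re|)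
      (fun k _ => abs_nonneg _) (Finset.mem_univ j))
    (fun _ => ⟨1, one_pos, Set.toFinite _⟩)
    (fun x => by rw [tsum_fintype]; exact hM x) (μ := lam j₀) (hre j₀ j₀.2) {j₀}
    (fun j => by
      rw [Finset.mem_singleton]
      exact ⟨fun h => by rw [h], fun h =>
        Subtype.ext (hinj (Finset.mem_coe.2 j.2) (Finset.mem_coe.2 j₀.2) h)⟩)
  rw [Finset.sum_singleton] at key
  exact mul_ne_zero (hc j₀ j₀.2) hj₀ key

/-- **(b) Uniformity on the unit sphere.** Under the hypotheses of
`stub_expPolyDominates_unbounded`, for every real `K` finitely many abscissae `t ⊆ ℝ` suffice: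
every coefficient vector `v` on `↥s` with `∑ⱼ ‖vⱼ‖² = 1` has some `x ∈ t` with
`K < ‖∑ⱼ cⱼ vⱼ e^{λⱼ x}‖²` (the unit sphere of `↥s → ℂ` is compact, the sets
`{v | K < ‖∑ⱼ cⱼ vⱼ e^{λⱼ x}‖²}` are open and cover it by (a); take a finite subcover).
[folklore] -/
theorem stub_expPolyDominates_finite_abscissae {ι : Type} {s : Finset ι} {lam c : ι → ℂ}
    (hinj : Set.InjOn lam ↑s) (hre : ∀ i ∈ s, (lam i).re ≠ 0) (hc : ∀ i ∈ s, c i ≠ 0)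
    (K : ℝ) : ∃ t : Finset ℝ, ∀ v : ↥s → ℂ, ∑ j : ↥s, ‖v j‖ ^ 2 = 1 →
      ∃ x ∈ t, K < ‖∑ j : ↥s, c j * v j * cexp (lam j * x)‖ ^ 2 := by
  have hScpt : IsCompact {v : ↥s → ℂ | ∑ j : ↥s, ‖v j‖ ^ 2 = 1} := by
    refine Metric.isCompact_of_isClosed_isBounded
      (isClosed_eq (by fun_prop) continuous_const) ?_
    refine isBounded_iff_forall_norm_le.2 ⟨1, fun v hv => ?_⟩
    have hv' : ∑ j : ↥s, ‖v j‖ ^ 2 = 1 := hv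
    rw [pi_norm_le_iff_of_nonneg zero_le_one]
    intro j
    have h1 : ‖v j‖ ^ 2 ≤ 1 := by
      rw [← hv']
      exact Finset.single_le_sum (f := fun k => ‖v k‖ ^ 2) (fun k _ => sq_nonneg _)
        (Finset.mem_univ j)
    exact (sq_le_one_iff₀ (norm_nonneg _)).1 h1
  have hUo : ∀ x : ℝ,
      IsOpen {v : ↥s → ℂ | K < ‖∑ j : ↥s, c j * v j * cexp (lam j * x)‖ ^ 2} :=
    fun x => isOpen_lt continuous_const (by fun_prop)
  have hcover : {v : ↥s → ℂ | ∑ j : ↥s, ‖v j‖ ^ 2 = 1} ⊆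
      ⋃ x : ℝ, {v : ↥s → ℂ | K < ‖∑ j : ↥s, c j * v j * cexp (lam j * x)‖ ^ 2} := by
    intro v hv
    have hv' : ∑ j : ↥s, ‖v j‖ ^ 2 = 1 := hv
    have hv0 : v ≠ 0 := by
      intro h0
      rw [h0] at hv'
      simp at hv'
    obtain ⟨x, hx⟩ := stub_expPolyDominates_unbounded hinj hre hc hv0 (Real.sqrt K)
    exact Set.mem_iUnion.2 ⟨x, Real.lt_sq_of_sqrt_lt hx⟩
  obtain ⟨t, ht⟩ := hScpt.elim_finite_subcover _ hUo hcover
  refine ⟨t, fun v hv => ?_⟩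
  obtain ⟨x, hxt, hx⟩ := Set.mem_iUnion₂.1 (ht hv)
  exact ⟨x, hxt, hx⟩

/-- **Stub C2 — exponential polynomials dominate every quadratic bound on long intervals.** For
finitely many DISTINCT exponents `λᵢ` off the imaginary axis and non-zero weights `cᵢ`, and any
real `K`, there is a length `L ≥ 0` such that no coefficient vector `w`, non-zero somewhere on
`s`, keeps `‖∑ᵢ cᵢ wᵢ e^{λᵢ x}‖² ≤ K · ∑ᵢ ‖wᵢ‖²` on all of `[−L, L]` (finitely many abscissae from
`stub_expPolyDominates_finite_abscissae`, then homogeneity `w = r · v` with `v` on the unit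
sphere, `r² = ∑ᵢ ‖wᵢ‖²`). [folklore] -/
theorem stub_expPolyDominates : ∀ {ι : Type} (s : Finset ι) (lam c : ι → ℂ),
    Set.InjOn lam ↑s → (∀ i ∈ s, (lam i).re ≠ 0) → (∀ i ∈ s, c i ≠ 0) →
    ∀ K : ℝ, ∃ L : ℝ, 0 ≤ L ∧ ∀ w : ι → ℂ,
      (∀ x : ℝ, |x| ≤ L →
        ‖∑ i ∈ s, c i * w i * cexp (lam i * x)‖ ^ 2 ≤ K * ∑ i ∈ s, ‖w i‖ ^ 2) →
      ∀ i ∈ s, w i = 0 := by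
  intro ι s lam c hinj hre hc K
  obtain ⟨t, ht⟩ := stub_expPolyDominates_finite_abscissae hinj hre hc K
  refine ⟨∑ x ∈ t, |x|, Finset.sum_nonneg fun x _ => abs_nonneg x, fun w hw => ?_⟩
  by_contra! hne
  obtain ⟨i₀, hi₀, hwi₀⟩ := hne
  -- the squared norm `ρ` of `w` on `s` and its square root `r`
  have hρ : 0 < ∑ i ∈ s, ‖w i‖ ^ 2 :=
    lt_of_lt_of_le (by positivity) (Finset.single_le_sum (f := fun i => ‖w i‖ ^ 2)
      (fun k _ => sq_nonneg _) hi₀)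
  set ρ : ℝ := ∑ i ∈ s, ‖w i‖ ^ 2 with hρdef
  have hr : 0 < Real.sqrt ρ := Real.sqrt_pos.2 hρ
  have hr2 : Real.sqrt ρ ^ 2 = ρ := Real.sq_sqrt hρ.le
  -- the normalised coefficient vector `v = w / r` on `↥s` lies on the unit sphere
  obtain ⟨x, hxt, hx⟩ := ht (fun j => ((Real.sqrt ρ : ℝ) : ℂ)⁻¹ * w j) (by
    simp only [norm_mul, norm_inv, Complex.norm_real, Real.norm_eq_abs, abs_of_pos hr,
      mul_pow, ← Finset.mul_sum]
    rw [Finset.sum_coe_sort s (fun i => ‖w i‖ ^ 2), ← hρdef, inv_pow, hr2,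
      inv_mul_cancel₀ hρ.ne'])
  have hxL : |x| ≤ ∑ y ∈ t, |y| :=
    Finset.single_le_sum (f := fun y : ℝ => |y|) (fun y _ => abs_nonneg y) hxt
  have hb := hw x hxL
  have hGv : ∑ j : ↥s, c j * (((Real.sqrt ρ : ℝ) : ℂ)⁻¹ * w j) * cexp (lam j * x) =
      ((Real.sqrt ρ : ℝ) : ℂ)⁻¹ * ∑ i ∈ s, c i * w i * cexp (lam i * x) := by
    rw [Finset.mul_sum, ← Finset.sum_coe_sort s]
    exact Finset.sum_congr rfl fun j _ => by ring
  have hle : ‖∑ j : ↥s, c j * (((Real.sqrt ρ : ℝ) : ℂ)⁻¹ * w j) * cexp (lam j * x)‖ ^ 2 ≤ K := by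
    rw [hGv, norm_mul, norm_inv, Complex.norm_real, Real.norm_eq_abs, abs_of_pos hr, mul_pow,
      inv_pow, hr2]
    calc ρ⁻¹ * ‖∑ i ∈ s, c i * w i * cexp (lam i * x)‖ ^ 2 ≤ ρ⁻¹ * (K * ρ) :=
          mul_le_mul_of_nonneg_left hb (inv_nonneg.2 hρ.le)
      _ = K := by rw [mul_comm K ρ, ← mul_assoc, inv_mul_cancel₀ hρ.ne', one_mul]
  exact absurd hx (not_lt.2 hle)

end Summit.RiemannHypothesis.RiemannHypothesis.Theorems.RuelleBandCofiniteCriticalLine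

end
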